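import Mathlib.Analysis.SpecialFunctions.Pow.Real
import Mathlib.Analysis.Calculus.Gradient.Basic
import Mathlib.Analysis.Calculus.IteratedDeriv.Defs
import Mathlib.Analysis.Calculus.ContDiff.Basic
import Mathlib.Analysis.InnerProductSpace.PiL2
import Mathlib.LinearAlgebra.Trace
import Mathlib.MeasureTheory.Integral.Bochner.Basic
import Mathlib.MeasureTheory.Measure.Haar.InnerProductSpace
import Literature.Analysis.FunctionSpaces.FlatTorus
import HarnessLib

/-!
# The Alberti–Crippa–Mazzucato family in its native planar setting (Bruè–De Lellis 2023,
Thm. 4.1 with (4.3)–(4.4), (4.9)–(4.10); Alberti–Crippa–Mazzucato 2019, §§6.2, 8.4–8.8)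

Topic `Literature/Analysis/FluidPDE`. The tree vendors Bruè–De Lellis, CMP 400 (2023), Thm. 4.1
on the flat torus `T²` (`Literature.Analysis.FluidPDE.alberti_crippa_mazzucato_family`,
`QuasiSelfSimilarMixing.lean`), which is how the theorem is *used* (BDL §5, first paragraph:
"Thanks to (a) and (b) we can make both `ρ_n` and `v_n` `1`-periodic, hence defined on the
`2d`-torus"; Cheskidov 2023, Thm. 3.1). The theorem itself is *stated and built* on the unit
square of the plane: "a family `{(ρ_n, v_n)}` of smooth solutions to the transport equation in
`[0,1]² × [0,1]` with the following structure
`ρ_n(x,t) = Σ_{Q ∈ 𝒬(2·5ⁿ)} χ_Q(x) Θ_{i(Q)}(2·5ⁿ(x - r(Q)), t)`,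
`v_n(x,t) = Σ_{Q ∈ 𝒬(2·5ⁿ)} χ_Q(x) (2·5ⁿ)⁻¹ V_{i(Q)}(2·5ⁿ(x - r(Q)), t)`" (BDL (4.3)–(4.4)),
the building blocks `Θ_i` having zero average and unit `L²` mass on the unit square (BDL §4.1
(ii)), and the whole configuration vanishing near `∂[0,1]²` at every level (ACM 2019, §8.6:
"the velocity field `u` vanishes in a neighborhood of the boundary of `Q`"; §8.4 (a)–(b) for
the scalar). This file vendors that planar statement as the named fact
`alberti_crippa_mazzucato_planar_family`, keeping from the patching structure exactly the two
consequences that the torus packaging needs and that BDL print or display: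

* the estimates (a) and (4.9)–(4.10) at **integer** orders `α = j ∈ ℕ`, as sup norms over `ℝ²`
  of `Dʲ ∂ₜᵏ v_n(·,t)` and `Dʲ ∂ₜᵏ (v_n·∇v_n)(·,t)`, `≤ C(j,k) 5^{(j-1)n}` — for the velocity this
  is (a) at integer `α` (the `Cʲ` norm dominates each `‖Dⁱ·‖_∞`, `i ≤ j`, and conversely); for
  the convective term, (4.9) is the displayed identity
  `(v_n·∇v_n)(x,t) = Σ_Q χ_Q(x) (2·5ⁿ)⁻¹ (V_{i(Q)}·∇V_{i(Q)})(2·5ⁿ(x - r(Q)), t)`, whose `Cʲ` norms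
  scale as printed in (4.10) (there for `α > 0`; the case `j = 0` is (4.9) itself);
* the cell structure behind (b): `ρ_n(·,t)` has zero average on every square of `𝒬(2·5ⁿ)`
  ((4.3) with (ii)), together with the printed clauses of (b): `∫ρ_n = 0`, `∫ρ_n² = 1`,
  `‖ρ_n‖_∞ ≤ 10`, `‖∇ρ_n‖_∞ ≤ C 5ⁿ`.

The fractional-order Hölder bounds (every `α ≥ 0`) and the mixing bound `‖ρ_n(t)‖_{Ḣ⁻¹} ≤ C 5⁻ⁿ`
of (a)–(b) are *not* clauses here: on the torus they follow from the clauses above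
(interpolation `[Dʲf]_r ≤ 2^{1-r}‖Dʲf‖_∞^{1-r}‖D^{j+1}f‖_∞^r`; duality and the Poincaré–Wirtinger
inequality on the cells of mesh `(2·5ⁿ)⁻¹`), which is the content of the reduction
`alberti_crippa_mazzucato_family_of_planar` (file `QuasiSelfSimilarMixingProofs`). Item (c) is
rendered per level (`K_n ⋐ (0,1)²`), the reading consistent with (4.3) + (ii) (see the discussion
in `QuasiSelfSimilarMixing.lean`) and with ACM §8.6; item (d) is `ρ_n(·,1) = ρ_{n+1}(·,0)`.

## Lean rendering

* The plane is `E² = EuclideanSpace ℝ (Fin 2)`; fields are time-first, `ρ : ℕ → ℝ → E² → ℝ`,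
  `v : ℕ → ℝ → E² → E²`; "`C^∞([0,1]² × [0,1])` and vanishing near `∂[0,1]²`" is
  `ContDiffOn ℝ ∞` of the uncurried field on `Icc 0 1 ×ˢ univ` plus vanishing outside a compact
  `K_n ⊆ (0,1)²` for `t ∈ [0,1]` (nothing is asserted for `t ∉ [0,1]`).
* `∂ₜ` within `[0,1]` is the one-sided `derivWithin · (Icc 0 1)`, `∂ₜᵏ` is
  `iteratedDerivWithin k · (Icc 0 1)` (the convention of `Torus.timeDerivWithin`); space
  derivatives are Mathlib's `gradient`, `fderiv`, `iteratedFDeriv`; `(v·∇)v = Dv[v]`;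
  `div v = tr Dv`.
* The cells of `𝒬(N)`, `N = 2·5ⁿ`, are the half-open squares `m/N + N⁻¹[0,1)² = ∏ᵢ [mᵢ/N, (mᵢ+1)/N)`,
  written `{y | (N : ℝ) • y - latticeVec m ∈ unitCube (Fin 2)}` with the accepted
  `Torus.unitCube`, `Torus.latticeVec` (`FlatTorus.lean`), and indexed by all `m ∈ ℤ²` (cells
  outside `[0,1)²` carry the zero function, so the clause is trivially true there); they differ
  from BDL's open squares by null sets.
* Integrals are over `ℝ²` (`volume` on `E²`); by the support clause they equal the printed
  integrals over `(0,1)²`.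

## Status of the fact (2026-08-15): proved modulo `acm_compatible_blocks`

* `alberti_crippa_mazzucato_planar_family` is Bruè–De Lellis, Thm. 4.1 itself, in the planar
  form in which it is printed (BDL p. 9: "The following result is taken from
  [AlbertiCrippaMazzucato16]"; its proof there is the sentence "This requires a delicate
  combinatorial construction which is explained in detail in [AlbertiCrippaMazzucato16]"). It is
  the same theorem as the torus fact `alberti_crippa_mazzucato_family`
  (`QuasiSelfSimilarMixing.lean`), not a sub-result of it: the torus fact follows from it by
  periodisation (`alberti_crippa_mazzucato_family_of_planar'`, `QuasiSelfSimilarMixingProofs.lean`,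
  BDL §5, first paragraph), and the torus fact is also proved without it
  (`alberti_crippa_mazzucato_family_of_building_blocks`, `QuasiSelfSimilarFamilyProofs.lean`).
* It is PROVED modulo the one geometric named fact of this cluster:
  `alberti_crippa_mazzucato_planar_family_of_acm_building_blocks`
  (`QuasiSelfSimilarPlanarProofs.lean`) derives it from `acm_building_blocks`
  (`QuasiSelfSimilarBuildingBlocks.lean`), `acm_building_blocks_of_compatible_blocks`
  (`QuasiSelfSimilarCompatibleBlocksProofs.lean`) derives that from `acm_compatible_blocks`
  (`QuasiSelfSimilarCompatibleBlocks.lean`), and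
  `alberti_crippa_mazzucato_planar_family_of_compatible_blocks` (ibid.) is the composite. The
  discharge of this declaration is therefore the term
  `alberti_crippa_mazzucato_planar_family_of_compatible_blocks acm_compatible_blocks_holds` as
  soon as `acm_compatible_blocks_holds` exists; no separate construction belongs to this file.
* The remaining fact `acm_compatible_blocks` is the kinematics of Alberti–Crippa–Mazzucato 2019,
  §8.4–8.5 for the two generating curves `Γ₁, Γ₂` of §8.1 (conditions (a)–(e); reduced set (b),
  (c′), (c″), (d′), (e) of §8.3). The source prints these conditions and the verifications
  downstream of them (§8.4–8.8, with the canonical tube fields of §7: Prop. 21, Lemma 23 — whose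
  Jacobian identity is `AlbertiCrippaMazzucato.areaForm_fderiv_tubularMap_eq_one`,
  `AreaPreservingTubularMap.lean` — and Lemma 25), but gives the curves only by the figures of
  §8.9–8.11 (arXiv:1605.02090, p. 27: "Due to the complexity that a rigorous construction would
  entail, we only give a precise description of the initial states `Γ₁(0)`, `Γ₂(0)`, and of the
  final states `Γ₁(1)`, `Γ₂(1)` … and sketch some of the intermediate states"). A Lean discharge
  of `acm_compatible_blocks` has to supply explicit smooth isotopies meeting those conditions; that
  single obligation stands behind `acm_building_blocks`, this declaration and
  `alberti_crippa_mazzucato_family` alike (the `n`-uniform variant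
  `alberti_crippa_mazzucato_quasi_self_similar` is not on this chain, see
  `QuasiSelfSimilarMixing.lean`).

## References

* E. Bruè, C. De Lellis, *Anomalous dissipation for the forced 3D Navier–Stokes equations*,
  Comm. Math. Phys. 400 (2023), 1507–1533, §4.1 (i)–(iv), Thm. 4.1 (a)–(d) with (4.3)–(4.4),
  §4.3 (4.9)–(4.10) (arXiv:2207.06301, p. 9).
* G. Alberti, G. Crippa, A. L. Mazzucato, *Exponential self-similar mixing by incompressible
  flows*, J. Amer. Math. Soc. 32 (2019), 445–490, §6.2 (quasi self-similar construction),
  Lemma 18, §8.4 (a)–(c), §§8.6–8.8 (arXiv:1605.02090).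
* A. Cheskidov, *Dissipation anomaly and anomalous dissipation in incompressible fluid flows*,
  arXiv:2311.04182 (2023), Thm. 3.1.
-/

noncomputable section

open MeasureTheory Set
open scoped InnerProductSpace ContDiff

namespace Literature.Analysis.FluidPDE

/-- **The Alberti–Crippa–Mazzucato quasi-self-similar family on the unit square of the plane**
(Bruè–De Lellis, CMP 400 (2023), Thm. 4.1 (a), (b), (d) with the patching structure
(4.3)–(4.4) and §4.3 (4.9)–(4.10); construction of Alberti–Crippa–Mazzucato, JAMS 32 (2019),
§6.2 and §§8.4–8.8; item (c) in its per-level reading, ACM §8.6). There exist, for every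
`n ∈ ℕ`, a scalar `ρ_n` and a drift `v_n`, `C^∞` on `[0,1] × ℝ²`, such that:
(smooth) `ρ_n, v_n ∈ C^∞([0,1] × ℝ²)`;
(c) for every `n` there is a compact `K_n ⊆ (0,1)²` outside which `ρ_n(·,t)` and `v_n(·,t)`
vanish for all `t ∈ [0,1]`;
(transport) `∂ₜρ_n + v_n·∇ρ_n = 0` and `div v_n = 0` on `[0,1] × ℝ²` (one-sided `∂ₜ` at
`t = 0, 1`);
(a, integer orders) for all `j, k ∈ ℕ` there is `C(j,k)` with
`‖Dʲ(∂ₜᵏ v_n(·,t))(y)‖ ≤ C(j,k) 5^{(j-1)n}` for all `n`, `t ∈ [0,1]`, `y ∈ ℝ²`;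
((4.9)–(4.10), integer orders) likewise `‖Dʲ(∂ₜᵏ (v_n·∇v_n)(·,t))(y)‖ ≤ C(j,k) 5^{(j-1)n}`;
(b) `∫ρ_n(·,t) = 0`, `∫ρ_n(·,t)² = 1`, `|ρ_n(y,t)| ≤ 10` for all `n`, `t ∈ [0,1]`, `y`, and
there is an absolute `C` with `‖∇ρ_n(y,t)‖ ≤ C 5ⁿ`;
((4.3) + (ii)) `∫_Q ρ_n(·,t) = 0` for every cell `Q = m/(2·5ⁿ) + (2·5ⁿ)⁻¹[0,1)²`, `m ∈ ℤ²`, of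
the grid of mesh `(2·5ⁿ)⁻¹`;
(d) `ρ_n(·,1) = ρ_{n+1}(·,0)`.
Not included (consequences, proved in `QuasiSelfSimilarMixingProofs`): the bounds of (a) and
(4.10) at fractional Hölder orders and `‖ρ_n(t)‖_{Ḣ⁻¹(T²)} ≤ C 5⁻ⁿ` of (b). See the module
docstring for the rendering of derivatives, cells and integrals.
[cite: BrueDeLellisCMP2023, Thm. 4.1 with (4.3)–(4.4) and (4.9)–(4.10)] [cite: AlbertiCrippaMazzucato2019, §6.2, §§8.4–8.8] [cite: Cheskidov2023, Thm. 3.1] -/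
def alberti_crippa_mazzucato_planar_family : Prop :=
  ∃ (ρ : ℕ → ℝ → EuclideanSpace ℝ (Fin 2) → ℝ)
    (v : ℕ → ℝ → EuclideanSpace ℝ (Fin 2) → EuclideanSpace ℝ (Fin 2)),
    -- smoothness on `[0,1] × ℝ²`
    (∀ n, ContDiffOn ℝ ∞ (fun p : ℝ × EuclideanSpace ℝ (Fin 2) => ρ n p.1 p.2) (Icc 0 1 ×ˢ univ) ∧
      ContDiffOn ℝ ∞ (fun p : ℝ × EuclideanSpace ℝ (Fin 2) => v n p.1 p.2) (Icc 0 1 ×ˢ univ)) ∧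
    -- (c), per level: supports in a compact subset of the open unit square
    (∀ n, ∃ K : Set (EuclideanSpace ℝ (Fin 2)), IsCompact K ∧
      K ⊆ {y | ∀ i, y i ∈ Ioo (0 : ℝ) 1} ∧
      ∀ t ∈ Icc (0 : ℝ) 1, ∀ y ∉ K, ρ n t y = 0 ∧ v n t y = 0) ∧
    -- transport equation and incompressibility on `[0,1] × ℝ²`
    (∀ n, ∀ t ∈ Icc (0 : ℝ) 1, ∀ y,
      derivWithin (fun s => ρ n s y) (Icc 0 1) t + ⟪v n t y, gradient (ρ n t) y⟫_ℝ = 0 ∧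
      LinearMap.trace ℝ _ (fderiv ℝ (v n t) y : EuclideanSpace ℝ (Fin 2) →ₗ[ℝ] _) = 0) ∧
    -- (a) at integer orders: `‖Dʲ ∂ₜᵏ v_n(·,t)‖_∞ ≤ C(j,k) 5^{(j-1)n}`
    (∀ j k : ℕ, ∃ C : ℝ, ∀ n : ℕ, ∀ t ∈ Icc (0 : ℝ) 1, ∀ y,
      ‖iteratedFDeriv ℝ j (fun z => iteratedDerivWithin k (fun s => v n s z) (Icc 0 1) t) y‖ ≤
        C * (5 : ℝ) ^ (((j : ℝ) - 1) * n)) ∧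
    -- (4.9)–(4.10) at integer orders: `‖Dʲ ∂ₜᵏ (v_n·∇v_n)(·,t)‖_∞ ≤ C(j,k) 5^{(j-1)n}`
    (∀ j k : ℕ, ∃ C : ℝ, ∀ n : ℕ, ∀ t ∈ Icc (0 : ℝ) 1, ∀ y,
      ‖iteratedFDeriv ℝ j (fun z => iteratedDerivWithin k
          (fun s => fderiv ℝ (v n s) z (v n s z)) (Icc 0 1) t) y‖ ≤
        C * (5 : ℝ) ^ (((j : ℝ) - 1) * n)) ∧
    -- (b): zero mean, unit `L²` mass, `L^∞ ≤ 10`, `‖∇ρ_n‖_∞ ≤ C 5ⁿ`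
    (∀ n : ℕ, ∀ t ∈ Icc (0 : ℝ) 1,
      ∫ y, ρ n t y = 0 ∧ ∫ y, ρ n t y ^ 2 = 1 ∧ ∀ y, |ρ n t y| ≤ 10) ∧
    (∃ C : ℝ, ∀ n : ℕ, ∀ t ∈ Icc (0 : ℝ) 1, ∀ y, ‖gradient (ρ n t) y‖ ≤ C * 5 ^ n) ∧
    -- (4.3) + (ii): zero average on every cell of mesh `(2·5ⁿ)⁻¹`
    (∀ n : ℕ, ∀ t ∈ Icc (0 : ℝ) 1, ∀ m : Fin 2 → ℤ,
      ∫ y in {y : EuclideanSpace ℝ (Fin 2) |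
          ((2 * 5 ^ n : ℕ) : ℝ) • y - FunctionSpaces.Torus.latticeVec m ∈
            FunctionSpaces.Torus.unitCube (Fin 2)}, ρ n t y = 0) ∧
    -- (d): handover
    (∀ n : ℕ, ρ n 1 = ρ (n + 1) 0)

/-- Handover along the planar family, read backwards: `ρ_{n+1}(·,0) = ρ_n(·,1)` (BDL 2023,
Thm. 4.1 (d)). [cite: BrueDeLellisCMP2023, Thm. 4.1 (d)] -/
theorem alberti_crippa_mazzucato_planar_family.handover
    (h : alberti_crippa_mazzucato_planar_family) :
    ∃ (ρ : ℕ → ℝ → EuclideanSpace ℝ (Fin 2) → ℝ)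
      (v : ℕ → ℝ → EuclideanSpace ℝ (Fin 2) → EuclideanSpace ℝ (Fin 2)),
      (∀ n, ∀ t ∈ Icc (0 : ℝ) 1, ∀ y,
        derivWithin (fun s => ρ n s y) (Icc 0 1) t + ⟪v n t y, gradient (ρ n t) y⟫_ℝ = 0) ∧
      ∀ n, ρ (n + 1) 0 = ρ n 1 := by
  obtain ⟨ρ, v, -, -, htr, -, -, -, -, -, hd⟩ := h
  exact ⟨ρ, v, fun n t ht y => (htr n t ht y).1, fun n => (hd n).symm⟩

/-- The support clause in "margin" form: at level `n` there is `δ > 0` such that `ρ_n(·,t)` and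
`v_n(·,t)`, `t ∈ [0,1]`, vanish at every point having a coordinate outside `[δ, 1-δ]` (a compact
subset of the open square keeps a positive distance from its boundary). [folklore] -/
theorem alberti_crippa_mazzucato_planar_family.exists_margin
    (h : alberti_crippa_mazzucato_planar_family) :
    ∃ (ρ : ℕ → ℝ → EuclideanSpace ℝ (Fin 2) → ℝ)
      (v : ℕ → ℝ → EuclideanSpace ℝ (Fin 2) → EuclideanSpace ℝ (Fin 2)),
      (∀ n, ρ n 1 = ρ (n + 1) 0) ∧
      ∀ n, ∃ δ : ℝ, 0 < δ ∧ ∀ t ∈ Icc (0 : ℝ) 1, ∀ y : EuclideanSpace ℝ (Fin 2),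
        (∃ i, y i ∉ Icc δ (1 - δ)) → ρ n t y = 0 ∧ v n t y = 0 := by
  obtain ⟨ρ, v, -, hK, -, -, -, -, -, -, hd⟩ := h
  refine ⟨ρ, v, hd, fun n => ?_⟩
  obtain ⟨K, hKc, hKsub, hK0⟩ := hK n
  rcases K.eq_empty_or_nonempty with hKe | hKne
  · exact ⟨1 / 4, by norm_num, fun t ht y _ => hK0 t ht y (by simp [hKe])⟩
  · -- the continuous `g y = minᵢ min (yᵢ) (1 - yᵢ)` is positive on `K ⊆ (0,1)²`, hence bounded
    -- below on the compact `K` by its (positive) minimum `δ`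
    let g : EuclideanSpace ℝ (Fin 2) → ℝ := fun y => min (min (y 0) (1 - y 0)) (min (y 1) (1 - y 1))
    have hgc : Continuous g := by fun_prop
    obtain ⟨x₀, hx₀K, hx₀⟩ := hKc.exists_isMinOn hKne hgc.continuousOn
    have hx₀' := hKsub hx₀K
    have hpos : 0 < g x₀ := by
      simp only [g, lt_min_iff, sub_pos]
      exact ⟨⟨(hx₀' 0).1, (hx₀' 0).2⟩, (hx₀' 1).1, (hx₀' 1).2⟩
    refine ⟨g x₀, hpos, fun t ht y hy => hK0 t ht y fun hyK => ?_⟩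
    obtain ⟨i, hi⟩ := hy
    have hle : g x₀ ≤ g y := (isMinOn_iff.1 hx₀) y hyK
    have hgi : g y ≤ min (y i) (1 - y i) := by
      fin_cases i
      · exact min_le_left _ _
      · exact min_le_right _ _
    refine hi ⟨le_trans hle (hgi.trans (min_le_left _ _)), ?_⟩
    have := le_trans hle (hgi.trans (min_le_right _ _))
    linarith

end Literature.Analysis.FluidPDE

end
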